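import Literature.NumberTheory.EllipticCurves.LocalTorsionGoodReductionPPrimaryProofs
import Literature.NumberTheory.EllipticCurves.PastenValuationProductThm115Proofs
import Literature.NumberTheory.EllipticCurves.PadicPointsFiniteIndexProofs
import Literature.NumberTheory.EllipticCurves.LFunctionPrimeCoeff
import HarnessLib

/-!
# `#E(ℚ_p)[p^k] ≤ p` at an ADDITIVE prime `p ≥ 5`: `E(ℚ_p)[p^∞] ↪ E(ℚ_p)/E₁(ℚ_p)`, a group of
# order `c_p · #Ẽ_ns(𝔽_p) = c_p · p` with `c_p ≤ 4` (Silverman, *AEC* VII.2.1, VII.3.1, VII.6.1;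
# Ex. 3.5) — and the `t ≤ 1` binder of Kim's DEPTH-TWO twin discharged there

Sources: J. H. Silverman, *The Arithmetic of Elliptic Curves*, 2nd ed., GTM 106 (2009)
[SilvermanAEC2009]: Prop. VII.2.1 (`[E(ℚ_p) : E₁(ℚ_p)] = c_p · #Ẽ_ns(𝔽_p)`), Prop. VII.3.1 with
Thm. IV.6.1 (`E₁(ℚ_p)` has no `p`-torsion for `p ≥ 3`), Thm. VII.6.1 (Kodaira–Néron: `c_p ≤ 4`
unless the reduction is split multiplicative; *ATAEC* Cor. IV.9.2(d)), Prop. VII.5.1(c) (additive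
reduction ⟺ `v(Δ) > 0`, `v(c₄) > 0` on a minimal equation) and Exercise 3.5 (a cusp has
`#Ẽ_ns(𝔽_p) = p`); C.-H. Kim, Amer. J. Math. 148 (2026) = arXiv:2203.12159 [Kim2022StructureSelmer],
§3.1 / Prop. 3.2 (PDF p. 15): at an additive prime `E(ℚ_p)[p] ≠ 0` only for `p ∈ {2, 3, 5, 7}` on
explicit congruence classes; in particular `t = ord_p #E(ℚ_p)[p^∞] ≤ 1` at every additive `p ≥ 5`.

`Proofs`-style file (THEOREMS ONLY: no definition, no named fact, no instance; D-0026 net debt 0),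
sibling of `LocalTorsionGoodReductionPPrimaryProofs` (the good-reduction case). "Additive at `p`" is
spelled, as everywhere in the tree's prime-`p` currency, `¬ W.HasGoodReductionAtPrime p ∧
¬ W.HasMultiplicativeReductionAtPrime p`. What is proved:

> for `W/ℚ` globally minimal elliptic and a prime `p ≥ 5` of additive reduction, and every `k`,
> `#{Q ∈ W(ℚ_p) | p^k • Q = O} ≤ p`

(`natCard_localPPowTorsion_le_of_additive`). Proof, all from results the tree holds: `E₁(ℚ_p)` has
no `p`-power torsion (`eq_zero_of_isInReductionKernel_of_pow_nsmul`), so `W(ℚ_p)[p^k]` injects into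
`W(ℚ_p)/E₁(ℚ_p)` (`E₁ = E⁽¹⁾`, the tree's `formalFiltration 1`, of finite index
`finiteIndex_formalFiltration`), a finite group of order `[E : E₁] = c_p · #Ẽ_ns(𝔽_p)`
(`WeierstrassCurve.index_formalFiltration`) `= c_p · p` (a cusp: `p ∣ Δ`, `p ∣ c₄` on the integer
model by AEC VII.5.1(c), tree `hasAdditiveReductionAt_iff_of_isMinimalAt`, then
`natCard_point_of_Δ_eq_zero`); its `p`-primary component has order `p^m ∣ c_p · p` with
`c_p ≤ 4 < p` (`localTamagawaNumber_padic_le_four`), so `m ≤ 1`.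

## Statements
* §1 `dvd_Δ_and_dvd_c₄_integralModelInt_of_additive` (`p ∣ Δ(E₀)`, `p ∣ c₄(E₀)` for
  `E₀ = integralModelInt W`), `reductionPointCount_of_additive` (`N_p = #Ẽ_ns(𝔽_p) = p`),
  `localTamagawaNumber_padic_le_four_of_not_mult` (`c_p ≤ 4`), `index_formalFiltration_one_of_additive`
  (`[E(ℚ_p) : E₁(ℚ_p)] = c_p · p`).
* §2 `natCard_localPPowTorsion_le_of_additive` (the display), `natCard_localPSqTorsion_le_of_additive`
  (`k = 2`) — the `t ≤ 1` binder `Nat.card {Q // (p ^ 2 : ℕ) • Q = 0} ≤ p` of the DEPTH-TWO twin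
  `Kim2022_rankZero_padicValRat_sha_of_kuriharaNumber_ne_zero_of_maninConstant_depthTwo` (ARM P
  TY-QUEUE 11c) at an ADDITIVE `p ≥ 5` (reader bsd-cited-r10 ADDENDUM-2 sha16 2c7193b026c59569 P2:
  "additive: `E(ℚ_p)[p^∞] ↪ E₀/E₁ ≅ 𝔽_p` since `E₁(ℚ_p) ≅ ℤ_p` is torsion-free for `p ≥ 3` and
  `p ∤ c_p ≤ 4` … not yet a tree lemma, hence a binder" — it is a tree lemma now); with the good case
  (`natCard_localPSqTorsion_le_of_good`) the binder is automatic at every `p ≥ 5` that is not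
  multiplicative: `natCard_localPSqTorsion_le_of_not_mult`.
* §3 CONSUMER — `Kim2022_rankZero_padicValRat_sha_of_kuriharaNumber_ne_zero_of_maninConstant_depthTwo_of_not_mult`:
  the depth-two twin READ AT A NON-MULTIPLICATIVE `p` (good or additive) with the `t ≤ 1` binder
  discharged (proved; nothing asserted) — the shape of the BSD cited-literature audit's exit road
  (referee A R351.5: three analytic-rank-`0` classes ADDITIVE at `p = 5` with `t = 1`, consuming a
  level-two certificate). Nothing is booked here (ARM P, cell `bsd-cited`, 0 classes by design); no
  `Summits/` file is touched.

## References
* J. H. Silverman, *The Arithmetic of Elliptic Curves*, 2nd ed., GTM 106 (2009), Prop. VII.2.1,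
  Prop. VII.3.1, Thm. IV.6.1, Prop. VII.5.1(c), Thm. VII.6.1, Exercise 3.5. [SilvermanAEC2009]
* J. H. Silverman, *Advanced Topics in the Arithmetic of Elliptic Curves*, GTM 151 (1994),
  Cor. IV.9.2(d). [SilvermanATAEC1994]
* C.-H. Kim, Amer. J. Math. 148 (2026) = arXiv:2203.12159, §3.1 and Prop. 3.2 (PDF p. 15).
  [Kim2022StructureSelmer]
-/

noncomputable section

open scoped Classical

open WeierstrassCurve IsDedekindDomain NumberField Rat.HeightOneSpectrum Polynomial
  CongruenceSubgroup Literature.NumberTheory.EllipticCurves.ModularForms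

namespace Literature.NumberTheory.EllipticCurves

section LocalPPrimaryTorsionAdditive

variable (W : WeierstrassCurve ℚ) [W.IsElliptic] [W.IsGloballyMinimal] (p : ℕ) [hp : Fact p.Prime]

/-! ### §1 The integer model at an additive prime: `p ∣ Δ`, `p ∣ c₄`, `#Ẽ_ns(𝔽_p) = p`, `c_p ≤ 4` -/

omit [W.IsGloballyMinimal] in
/-- The place of `𝓞 ℚ` over `p`, with ADDITIVE reduction there when `W` is neither good nor
multiplicative at `p` (local trichotomy, AEC VII.5.1, tree
`hasGoodReductionAt_or_hasMultiplicativeReductionAt_or_hasAdditiveReductionAt`, and the tree's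
prime ↔ place bridges for good and multiplicative reduction). [cite: SilvermanAEC2009, VII.5 Prop. 5.1] -/
private theorem exists_place_of_additive (hng : ¬ W.HasGoodReductionAtPrime p)
    (hnm : ¬ W.HasMultiplicativeReductionAtPrime p) :
    ∃ v : HeightOneSpectrum (𝓞 ℚ), (primesEquiv v : ℕ) = p ∧ W.HasAdditiveReductionAt v := by
  set v : HeightOneSpectrum (𝓞 ℚ) := (primesEquiv (R := 𝓞 ℚ)).symm ⟨p, hp.out⟩ with hvdef
  have hv : primesEquiv v = ⟨p, hp.out⟩ := Equiv.apply_symm_apply _ _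
  refine ⟨v, congrArg Subtype.val hv, ?_⟩
  have hngv : ¬ W.HasGoodReductionAt v := by
    have key : ∀ q : Nat.Primes, primesEquiv v = q → W.HasGoodReductionAt v →
        (haveI := Fact.mk q.2; W.HasGoodReductionAtPrime (q : ℕ)) := by
      rintro q rfl h
      exact (hasGoodReductionAtPrime_iff_hasGoodReductionAt_ringOfIntegers (v := v) W).mpr h
    exact fun h ↦ hng (key ⟨p, hp.out⟩ hv h)
  have hnmv : ¬ W.HasMultiplicativeReductionAt v := by
    have key : ∀ q : Nat.Primes, primesEquiv v = q → W.HasMultiplicativeReductionAt v →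
        (haveI := Fact.mk q.2; W.HasMultiplicativeReductionAtPrime (q : ℕ)) := by
      rintro q rfl h
      exact (hasMultiplicativeReductionAtPrime_iff_hasMultiplicativeReductionAt_ringOfIntegers W v).mpr h
    exact fun h ↦ hnm (key ⟨p, hp.out⟩ hv h)
  rcases hasGoodReductionAt_or_hasMultiplicativeReductionAt_or_hasAdditiveReductionAt v W with
    h | h | h
  · exact absurd h hngv
  · exact absurd h hnmv
  · exact h

omit [W.IsElliptic] hp in
/-- `Δ(W) = Δ(E₀)` in `ℚ` for the integral model `E₀ = integralModelInt W`. [folklore] -/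
private theorem Δ_eq_cast_integralModelInt' : W.Δ = ((integralModelInt W).Δ : ℚ) := by
  rw [← cast_minimalDiscriminantInt W, minimalDiscriminantInt]

omit [W.IsElliptic] hp in
/-- `c₄(W) = c₄(E₀)` in `ℚ` for the integral model `E₀ = integralModelInt W`. [folklore] -/
private theorem c₄_eq_cast_integralModelInt' : W.c₄ = ((integralModelInt W).c₄ : ℚ) := by
  conv_lhs => rw [← map_integralModelInt W]
  rw [map_c₄, eq_intCast]

/-- **At an additive prime, `p ∣ Δ(E₀)` and `p ∣ c₄(E₀)`** for the integer model
`E₀ = integralModelInt W` of the globally minimal equation (Silverman *AEC* VII.5.1(c): on a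
minimal equation, additive reduction ⟺ `v(Δ) > 0 ∧ v(c₄) > 0`; tree
`hasAdditiveReductionAt_iff_of_isMinimalAt`). [cite: SilvermanAEC2009, VII.5 Prop. 5.1(c)] -/
theorem dvd_Δ_and_dvd_c₄_integralModelInt_of_additive (hng : ¬ W.HasGoodReductionAtPrime p)
    (hnm : ¬ W.HasMultiplicativeReductionAtPrime p) :
    (p : ℤ) ∣ (integralModelInt W).Δ ∧ (p : ℤ) ∣ (integralModelInt W).c₄ := by
  obtain ⟨v, hvp, haddv⟩ := exists_place_of_additive W p hng hnm
  have hmin : W.IsMinimalAt v := IsGloballyMinimal.isMinimalAt W v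
  obtain ⟨hΔv, hc₄v⟩ := (hasAdditiveReductionAt_iff_of_isMinimalAt hmin).mp haddv
  refine ⟨?_, ?_⟩
  · by_contra hnd
    have h1 : v.valuation ℚ W.Δ = 1 := by
      rw [Δ_eq_cast_integralModelInt' W]
      exact valuation_ringOfIntegers_intCast_eq_one v (by rw [hvp]; exact hnd)
    rw [h1] at hΔv
    exact lt_irrefl _ hΔv
  · by_contra hnd
    have h1 : v.valuation ℚ W.c₄ = 1 := by
      rw [c₄_eq_cast_integralModelInt' W]
      exact valuation_ringOfIntegers_intCast_eq_one v (by rw [hvp]; exact hnd)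
    rw [h1] at hc₄v
    exact lt_irrefl _ hc₄v

/-- **`N_p = #Ẽ_ns(𝔽_p) = p` at an additive prime** (the reduction of `E₀` is a cusp: `Δ = 0`,
`c₄ = 0` in `𝔽_p`, and a cuspidal cubic has `q` nonsingular points together with `Õ` — AEC Ex. 3.5,
tree `natCard_point_of_Δ_eq_zero`). [cite: SilvermanAEC2009, Exercise 3.5 and VII.5 Prop. 5.1(c)] -/
theorem reductionPointCount_of_additive (hng : ¬ W.HasGoodReductionAtPrime p)
    (hnm : ¬ W.HasMultiplicativeReductionAtPrime p) : reductionPointCount W p = p := by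
  obtain ⟨hΔ, hc₄⟩ := dvd_Δ_and_dvd_c₄_integralModelInt_of_additive W p hng hnm
  set V : WeierstrassCurve (ZMod p) := (integralModelInt W).map (Int.castRingHom (ZMod p)) with hV
  have hΔV : V.Δ = 0 := by
    rw [hV, map_Δ, eq_intCast, ZMod.intCast_zmod_eq_zero_iff_dvd]
    exact hΔ
  have hc₄V : V.c₄ = 0 := by
    rw [hV, map_c₄, eq_intCast, ZMod.intCast_zmod_eq_zero_iff_dvd]
    exact hc₄
  have h := (V.natCard_point_of_Δ_eq_zero hΔV).2.2 hc₄V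
  rw [Nat.card_zmod] at h
  exact h

omit [W.IsGloballyMinimal] in
/-- **`c_p ≤ 4` at a prime that is not multiplicative** (Kodaira–Néron, AEC Thm. VII.6.1 / *ATAEC*
Cor. IV.9.2(d); tree `localTamagawaNumber_padic_le_four`: the bound holds unless the `ℤ_p`-minimal
model has SPLIT multiplicative reduction, and `W.HasMultiplicativeReductionAtPrime p` is
multiplicative reduction of that model). [cite: SilvermanAEC2009, Thm VII.6.1]
[cite: SilvermanATAEC1994, Cor. IV.9.2(d) (PDF p. 340)] -/
theorem localTamagawaNumber_padic_le_four_of_not_mult (hnm : ¬ W.HasMultiplicativeReductionAtPrime p) :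
    (W.baseChange ℚ_[p]).localTamagawaNumber ℤ_[p] ≤ 4 := by
  haveI : (W.baseChange ℚ_[p]).IsElliptic := by rw [baseChange]; infer_instance
  exact localTamagawaNumber_padic_le_four p (W.baseChange ℚ_[p])
    (fun hs ↦ hnm hs.toHasMultiplicativeReduction)

omit [W.IsElliptic] in
/-- The number of points of Mathlib's reduction of `W ⊗ ℚ_p` is the tree's `reductionPointCount W p`
(both are `integralModelInt W` read modulo `p`; `reduction_baseChange_eq`,
`natCard_point_padicModel_residue`). [folklore] -/
private theorem natCard_point_reduction_baseChange_padic [(W.baseChange ℚ_[p]).IsMinimal ℤ_[p]] :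
    Nat.card ((W.baseChange ℚ_[p]).reduction ℤ_[p]).toAffine.Point = reductionPointCount W p := by
  have key : ∀ (X : WeierstrassCurve ℚ_[p]) [X.IsMinimal ℤ_[p]],
      ((integralModelInt W).map (Int.castRingHom ℤ_[p])).baseChange ℚ_[p] = X →
        Nat.card (X.reduction ℤ_[p]).toAffine.Point = reductionPointCount W p := by
    intro X _ hX
    subst hX
    rw [reduction_baseChange_eq]
    exact natCard_point_padicModel_residue W p
  exact key (W.baseChange ℚ_[p]) (padicModel_baseChange W p)

/-- **`[E(ℚ_p) : E₁(ℚ_p)] = c_p · p` at an additive prime** (AEC VII.2.1: `[E : E₁] = c_p · #Ẽ_ns(𝔽_p)`,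
tree `index_formalFiltration` at level `1`; and `#Ẽ_ns(𝔽_p) = p`).
[cite: SilvermanAEC2009, VII.2 Prop. 2.1 and Exercise 3.5] -/
theorem index_formalFiltration_one_of_additive (hng : ¬ W.HasGoodReductionAtPrime p)
    (hnm : ¬ W.HasMultiplicativeReductionAtPrime p) :
    ((W.baseChange ℚ_[p]).formalFiltration 1).index =
      (W.baseChange ℚ_[p]).localTamagawaNumber ℤ_[p] * p := by
  haveI : (W.baseChange ℚ_[p]).IsMinimal ℤ_[p] := isMinimal_map_padic_of_isGloballyMinimal W p
  haveI : (W.baseChange ℚ_[p]).IsElliptic := by rw [baseChange]; infer_instance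
  rw [index_formalFiltration (W.baseChange ℚ_[p]) (le_refl 1), pow_zero, mul_one,
    natCard_point_reduction_baseChange_padic W p, reductionPointCount_of_additive W p hng hnm]

/-! ### §2 `#E(ℚ_p)[p^k] ≤ p` at an additive prime `p ≥ 5` -/

/-- **`#{Q ∈ E(ℚ_p) | p^k • Q = O} ≤ p` at an additive prime `p ≥ 5`.** For `W/ℚ` globally minimal
elliptic, a prime `p ≥ 5` at which `W` is neither good nor multiplicative (additive reduction), and
any `k`: the `p^k`-torsion of `W(ℚ_p)` has at most `p` elements. Proof: `W(ℚ_p)[p^k]` meets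
`E₁(ℚ_p)` trivially (`eq_zero_of_isInReductionKernel_of_pow_nsmul`, `p ≥ 3`), so it injects into
`W(ℚ_p)/E₁(ℚ_p)`, a finite group of order `c_p · p` (§1), inside whose `p`-primary component (a
`p`-group, `IsPGroup.iff_card`, of order `p^m ∣ c_p · p`) it lands; as `c_p ≤ 4 < 5 ≤ p`, `p ∤ c_p`
and `m ≤ 1`. This is Kim's "`t ≤ 1` at additive `p ≥ 5`" (Prop. 3.2: at an additive prime a local
point of order `p` exists only for `p ≤ 7`, and `E(ℚ_p)[p^∞] ↪ E/E₁` bounds its number by `p`).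
[cite: SilvermanAEC2009, VII.2 Prop. 2.1, VII.3 Prop. 3.1 (with IV.6 Thm. 6.1), Thm VII.6.1, Exercise 3.5]
[cite: Kim2022StructureSelmer, §3.1 and Prop. 3.2 (PDF p. 15)] -/
theorem natCard_localPPowTorsion_le_of_additive (hp5 : 5 ≤ p) (hng : ¬ W.HasGoodReductionAtPrime p)
    (hnm : ¬ W.HasMultiplicativeReductionAtPrime p) (k : ℕ) :
    Nat.card {Q : (W.baseChange ℚ_[p]).toAffine.Point // (p ^ k : ℕ) • Q = 0} ≤ p := by
  haveI : (W.baseChange ℚ_[p]).IsMinimal ℤ_[p] := isMinimal_map_padic_of_isGloballyMinimal W p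
  haveI : (W.baseChange ℚ_[p]).IsElliptic := by rw [baseChange]; infer_instance
  set F1 := (W.baseChange ℚ_[p]).formalFiltration 1 with hF1
  set c := (W.baseChange ℚ_[p]).localTamagawaNumber ℤ_[p] with hc
  -- the quotient `G = E(ℚ_p)/E₁(ℚ_p)`: finite, of order `c · p`, `c ≤ 4`
  haveI hfi : F1.FiniteIndex := (W.baseChange ℚ_[p]).finiteIndex_formalFiltration 1
  have hidx : F1.index = c * p := index_formalFiltration_one_of_additive W p hng hnm
  have hc4 : c ≤ 4 := localTamagawaNumber_padic_le_four_of_not_mult W p hnm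
  set G := (W.baseChange ℚ_[p]).toAffine.Point ⧸ F1 with hG
  have hcardG : Nat.card G = c * p := hidx
  have hGpos : 0 < Nat.card G := by
    rw [hcardG]; exact Nat.pos_of_ne_zero (hidx ▸ hfi.index_ne_zero)
  haveI : Finite G := Nat.finite_of_card_ne_zero hGpos.ne'
  -- its `p`-primary component `Gp` has order `p^m ≤ p`
  set Gp := AddCommGroup.primaryComponent G p with hGp
  have hP : IsPGroup p (Multiplicative Gp) := by
    intro g
    obtain ⟨n, hn⟩ := (AddCommGroup.mem_primaryComponent).1 (Multiplicative.toAdd g).2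
    refine ⟨n, Multiplicative.toAdd.injective ?_⟩
    rw [toAdd_pow, toAdd_one]
    exact Subtype.ext (by simpa using hn)
  obtain ⟨m, hm0⟩ := IsPGroup.iff_card.1 hP
  have hm : Nat.card Gp = p ^ m := hm0
  have hGp_le : Nat.card Gp ≤ p := by
    have hdvd : Nat.card Gp ∣ Nat.card G :=
      Dvd.intro_left _ Gp.card_eq_card_quotient_mul_card_addSubgroup.symm
    rw [hm, hcardG] at hdvd
    -- `p^m ∣ c · p` with `p ∤ c` (as `0 < c ≤ 4 < p`) forces `m ≤ 1`
    have hm1 : m ≤ 1 := by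
      by_contra hm2
      have h2 : p ^ 2 ∣ c * p := (pow_dvd_pow p (by omega)).trans hdvd
      have hpc : p ∣ c := by
        have h' : p * p ∣ c * p := by simpa [pow_two] using h2
        exact (Nat.mul_dvd_mul_iff_right hp.out.pos).mp (by simpa [mul_comm] using h')
      have hc0 : 0 < c := Nat.pos_of_ne_zero fun h0 ↦ by
        rw [h0, zero_mul] at hcardG; exact hGpos.ne' hcardG
      exact absurd (Nat.le_of_dvd hc0 hpc) (by omega)
    rw [hm]
    calc p ^ m ≤ p ^ 1 := Nat.pow_le_pow_right hp.out.pos hm1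
      _ = p := pow_one p
  -- `W(ℚ_p)[p^k] ↪ Gp` by the quotient map
  set π : (W.baseChange ℚ_[p]).toAffine.Point →+ G := QuotientAddGroup.mk' F1 with hπ
  have hmem : ∀ Q : {Q : (W.baseChange ℚ_[p]).toAffine.Point // (p ^ k : ℕ) • Q = 0}, π Q.1 ∈ Gp := by
    intro Q
    rw [hGp, AddCommGroup.mem_primaryComponent]
    exact ⟨k, by rw [← map_nsmul, Q.2, map_zero]⟩
  let f : {Q : (W.baseChange ℚ_[p]).toAffine.Point // (p ^ k : ℕ) • Q = 0} → Gp :=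
    fun Q ↦ ⟨π Q.1, hmem Q⟩
  have hf : Function.Injective f := by
    intro Q Q' h
    have hQQ' : π Q.1 = π Q'.1 := congrArg (fun x : Gp ↦ (x : G)) h
    have hD : Q.1 - Q'.1 ∈ F1 := by
      rw [hπ, QuotientAddGroup.mk'_apply, QuotientAddGroup.mk'_apply, QuotientAddGroup.eq_iff_sub_mem]
        at hQQ'
      exact hQQ'
    have hker : (W.baseChange ℚ_[p]).IsInReductionKernel (Q.1 - Q'.1) := hD.1
    have h0 : p ^ k • (Q.1 - Q'.1) = 0 := by rw [nsmul_sub, Q.2, Q'.2, sub_self]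
    exact Subtype.ext (sub_eq_zero.mp
      (eq_zero_of_isInReductionKernel_of_pow_nsmul W p (by omega) k _ hker h0))
  exact (Nat.card_le_card_of_injective f hf).trans hGp_le

/-- **`#E(ℚ_p)[p²] ≤ p` at an additive `p ≥ 5`** — literally the `t ≤ 1` binder of the depth-two
twin `Kim2022_rankZero_padicValRat_sha_of_kuriharaNumber_ne_zero_of_maninConstant_depthTwo` there.
[cite: SilvermanAEC2009, VII.2 Prop. 2.1, VII.3 Prop. 3.1, Thm VII.6.1, Exercise 3.5]
[cite: Kim2022StructureSelmer, §3.1 and Prop. 3.2 (PDF p. 15)] -/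
theorem natCard_localPSqTorsion_le_of_additive (hp5 : 5 ≤ p) (hng : ¬ W.HasGoodReductionAtPrime p)
    (hnm : ¬ W.HasMultiplicativeReductionAtPrime p) :
    Nat.card {Q : (W.baseChange ℚ_[p]).toAffine.Point // (p ^ 2 : ℕ) • Q = 0} ≤ p :=
  natCard_localPPowTorsion_le_of_additive W p hp5 hng hnm 2

/-- **`#E(ℚ_p)[p²] ≤ p` at every `p ≥ 5` that is NOT multiplicative** (good:
`natCard_localPSqTorsion_le_of_good`; additive: `natCard_localPSqTorsion_le_of_additive`). So the
`t ≤ 1` binder of the depth-two twin needs a datum only at multiplicative primes (where `t` can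
exceed `1`: split with `p² ∣ v_p(Δ_min)`, Kim Prop. 3.1).
[cite: SilvermanAEC2009, VII.3 Prop. 3.1, Thm VII.6.1, Exercise 3.5 and 5.10]
[cite: Kim2022StructureSelmer, Prop. 3.1 and Prop. 3.2 (PDF p. 15)] -/
theorem natCard_localPSqTorsion_le_of_not_mult (hp5 : 5 ≤ p)
    (hnm : ¬ W.HasMultiplicativeReductionAtPrime p) :
    Nat.card {Q : (W.baseChange ℚ_[p]).toAffine.Point // (p ^ 2 : ℕ) • Q = 0} ≤ p := by
  by_cases hgood : W.HasGoodReductionAtPrime p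
  · exact natCard_localPSqTorsion_le_of_good W p (by omega) hgood
  · exact natCard_localPSqTorsion_le_of_additive W p hp5 hgood hnm

end LocalPPrimaryTorsionAdditive

/-! ### §3 Consumer: the depth-two twin at a non-multiplicative `p` -/

/-- **B7 DEPTH-TWO twin at a NON-MULTIPLICATIVE `p`** (good or additive) — C.-H. Kim, Amer. J. Math.
148, Thm. 1.8 (6), analytic rank `0`, a UNIT Kurihara number at a level `n ∈ 𝒩_2`, in the form
`Kim2022_rankZero_padicValRat_sha_of_kuriharaNumber_ne_zero_of_maninConstant_depthTwo` (ARM P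
TY-QUEUE 11c) with its `t ≤ 1` binder `#E(ℚ_p)[p²] ≤ p` DISCHARGED by
`¬ W.HasMultiplicativeReductionAtPrime p` (`natCard_localPSqTorsion_le_of_not_mult`). This is the
shape of the three rank-`0` exit cells of the BSD cited-literature audit (additive at `p = 5`,
`t = 1`; referee A R351.5), which therefore need only the level-two certificate and the usual B7
inputs. Proved (a reading of the twin; nothing asserted).
[cite: Kim2022StructureSelmer, Thm. 1.9 (6) (PDF p. 8), §3.1 and Prop. 3.2 (PDF p. 15)]
[cite: SilvermanAEC2009, VII.3 Prop. 3.1, Thm VII.6.1] -/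
theorem Kim2022_rankZero_padicValRat_sha_of_kuriharaNumber_ne_zero_of_maninConstant_depthTwo_of_not_mult
    (h : Kim2022_rankZero_padicValRat_sha_of_kuriharaNumber_ne_zero_of_maninConstant_depthTwo) :
    ∀ (W : WeierstrassCurve ℚ) [W.IsElliptic] [W.IsGloballyMinimal] (p : ℕ) [Fact p.Prime],
    5 ≤ p → ¬ W.HasMultiplicativeReductionAtPrime p → W.HasSurjectiveModNGaloisRep p →
    W.entireLFunction 1 ≠ 0 → Finite W.sha →
    ∀ {N : ℕ} [NeZero N] (D : ModularParametrizationData W N),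
    ¬ (p : ℤ) ∣ D.maninConstant →
    (∃ u : ℚ, ‖(u : ℚ_[p])‖ = 1 ∧ W.realPeriodRat = u * plusPeriod D.f) →
    ∀ (n : ℕ) [NeZero n], Kato.IsKolyvaginProduct W p 2 n →
    (∀ (ℓ : ℕ) [Fact ℓ.Prime], ℓ ∣ n →
      Nat.card {P : ((WeierstrassCurve.integralModelInt W).map
          (Int.castRingHom (ZMod ℓ))).toAffine.Point // p • P = 0} ≤ p) →
    ∀ ψ : (ℓ : ℕ) → (ZMod ℓ)ˣ →* Multiplicative (ZMod (p ^ 1)),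
      (∀ ℓ ∈ n.primeFactors, Function.Surjective (ψ ℓ)) →
      kuriharaNumber D.f (p ^ 1) n ψ ≠ 0 →
    ∃ q : ℚ, W.entireLFunction 1 / (W.realPeriodRat : ℂ) = (q : ℂ) ∧
      padicValRat p q = (padicValNat p (Nat.card (AddCommGroup.primaryComponent W.sha p)) : ℤ) :=
  fun W _ _ p _ hp hnm hsurj hL hfin _ _ D hc hu n _ hn hcyc ψ hψ hδ ↦
    h W p hp hsurj (natCard_localPSqTorsion_le_of_not_mult W p hp hnm) hL hfin D hc hu n hn
      hcyc ψ hψ hδ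

end Literature.NumberTheory.EllipticCurves

end
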